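import Mathlib.MeasureTheory.Measure.Prokhorov
import Mathlib.MeasureTheory.Measure.LevyProkhorovMetric
import Literature.Probability.LatticeModels.InterfaceSLE
import Literature.Probability.LatticeModels.DobrushinInterfaceExistence
import Literature.Probability.LatticeModels.LeftmostInterface
import HarnessLib

/-!
# Critical Ising interfaces and SLE₃: corrected statement (leftmost interface) and the CDHKS decomposition

Sibling of `Literature/Probability/LatticeModels/InterfaceSLE.lean` (crit-ising.S17), written by the
literature-prover holding tenure on the named fact
`Literature.Probability.LatticeModels.convergesInLawToSLE_three_isingInterface` (Chelkak–Duminil-Copin–Hongler–Kemppainen–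
Smirnov, *Convergence of Ising interfaces to Schramm's SLE curves*, C. R. Math. Acad. Sci. Paris 352
(2014) 157–161 = arXiv:1312.0533, Theorem 1; key `CDHKSCRAS2014`).

## 1. Why a corrected statement (`convergesInLawToSLE_three_isingInterface_zd`)

Auditing the fact against the source exhibited a mismatch between the two G02 objects the original
statement couples:

* its lattice measure `isingDobrushinMeasure E β` freezes the spins on the *vertex boundary*
  `meshBoundary Ω δ` only (free volume `meshInteriorFinset Ω δ = Ω_δ ∖ meshBoundary Ω δ`), whereas
* its interface predicate (`IsInterfaceSelection` → `IsDobrushinInterface` →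
  `DiscreteDobrushin.IsPlus` / `IsMinus`) reads the discrete arcs `zdArcA`, `zdArcB`, which live
  in the *polygonal boundary* `DiscreteDobrushin.zdBoundary ⊇ meshBoundary`, and admissibility
  (`IsZdAdmissible.zdBoundary_subset`) makes `zdBoundary = zdArcA ⊔ zdArcB`.

The difference `zdBoundary ∖ meshBoundary` consists of the *concave lattice corners* of `Ω_δ` (sites
whose four neighbours are `Ω_δ`-adjacent to them but which are a corner of a non-inner face); every
discretised non-rectangular Jordan domain has such corners at all small meshes. At those sites the
original statement samples a *free* spin (its measure is the Dobrushin Ising measure of the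
discrete domain with interior `Ω_δ ∖ meshBoundary` and boundary spins on `meshBoundary`) but lets
the interface predicate treat the site as a frozen `±` boundary spin: the selected curve is a
domain wall of the configuration overridden to `±` on `zdBoundary`, not an interface of the
sampled configuration, whereas CDHKS's Theorem 1 concerns the interface generated by the Dobrushin
boundary conditions of the sampled model (§1), the boundary being that of the polygonal domain
`Ω^δ_ℂ` (§2; Chelkak–Smirnov 2012, §2.2.1: spins free exactly on the inner vertices, `∓` imposed on
the two arcs of `∂Ω^δ`; G02's `zdBoundary` docstring: "every site not in the interior of the face
domain is frozen by the boundary conditions"). The module docstring of `InterfaceSLE`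
("`zdArcA ∪ zdArcB ⊆ meshBoundary`", "under admissibility `∂Ω_δ = zdArcA ⊔ zdArcB`, so this is
literally G02's `±` completion") describes an earlier `MedialInterface` whose arcs lived in
`meshBoundary` and went stale when G02 enlarged the boundary to `zdBoundary`. The original `Prop`
is therefore a statement about a variant object (the nominal-boundary domain wall of a model with
thermal corner spins; plausibly still converging to SLE₃ by boundary universality, but not the
printed theorem); it is left untouched (never edit a fact's meaning in place) and the faithful
transcription is vendored here under a new name, with the change that the free volume is
`Ω_δ ∖ zdBoundary` (`zdInteriorFinset`, measure `isingZdDobrushinMeasure`), the volume the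
interface predicate presupposes (and, since the review of §§3–4, for the leftmost interface of
CDHKS §1 instead of an arbitrary selection rule). `isPlus_iff_eq_one` / `isMinus_iff_eq_neg_one` record that with
this volume the predicate's `±`-completed spins are the sampled spins at every site, for every
configuration in the support of the measure (`ae_isingZdDobrushinMeasure_eq_dobrushinBC`).

## 2. Decomposition of CDHKS's proof (XL fact; named sub-facts, proved glue)

CDHKS prove Theorem 1 in two steps, which are vendored as two named facts about the corrected
objects:

* **§2, tightness** (`isTightMeasureSet_spinInterfaceLaw`): the interface laws `{γ^δ}` for small
  `δ` are tight on the curve space — CDHKS Thm 3 (= Kemppainen–Smirnov, arXiv:1212.6215, Thm 1.3: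
  Condition G ⇒ tightness), Condition G being supplied by the crossing bounds of Thm 4
  (= Chelkak–Duminil-Copin–Hongler, arXiv:1312.7785, Thm 1.1) and Remark 4 (spin case via the
  Edwards–Sokal coupling and FKG monotonicity; CDCH Cor. 1.7);
* **§3, identification** (`isSLELaw_three_of_subseqLimit_spinInterface`): every subsequential weak
  limit of the interface laws is the chordal SLE₃ law in `(Ω; a, b)` — the fermionic martingale
  observable of Chelkak–Smirnov (Invent. Math. 189 (2012), Thms 1.2 and 5.6) converges, its limit
  `M_t(z)` is a martingale for the Loewner evolution of the limiting curve (KS: the limit is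
  described by a Loewner chain with continuous driving process `W` having finite exponential
  moments), the expansion at `∞` shows that `W_t` and `W_t² - 3t` are martingales, and Lévy's
  characterisation gives `W = √3 B`.

The assembly "tight + all subsequential limits identified ⇒ convergence of the whole family" is
PROVED here in general form (`exists_tendsto_of_isTightMeasureSet`, from Mathlib's Prokhorov theorem
`isCompact_closure_of_isTightMeasureSet`, the Lévy–Prokhorov metrisability of
`ProbabilityMeasure X` and the subsequence criterion `Filter.tendsto_of_subseq_tendsto`), together
with the measurability clause of `ConvergesInLawToSLE` (`aemeasurable_isingMeasure`: an Ising
measure on the configurations of a countable graph is carried by the countable range of the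
gluing map, so every map out of the configuration space is a.e.-measurable). The reduction
`convergesInLawToSLE_three_isingInterface_zd_of_facts` then derives the corrected statement from
the two named facts and the uniqueness-in-law of chordal SLE (`IsSLECurve.map_eq`, a named fact of
`RandomPlanarGeometry/SLE.lean`, meanwhile proved: `IsSLECurve.map_eq_holds`,
`RandomPlanarGeometry/SLEUniquenessInLaw.lean`). Both named facts are themselves theories
(KS 2017 ≈ 80 pp., CS 2012 ≈ 65 pp., CDCH 2016 ≈ 30 pp.); their further reduction, by theorems
only, lives in the sibling files listed in §3.

## 3. Review of the split (D-0026/D-0027, 2026-08-15): apex, restated for the leftmost interface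

`convergesInLawToSLE_three_isingInterface_zd` was minted by the prove-seat of
`convergesInLawToSLE_three_isingInterface` (crit-ising.S17, spin half) and is therefore booked as a
decomposition child of it; its own prove-seat triaged it XL. The review, with the source open
(arXiv:1312.0533: §1 — the model, `β_crit = ½ log (1 + √2)`, Dobrushin boundary conditions
on the two arcs of `∂Ω^δ`, "We assume `γ^δ` to be the rightmost (or the leftmost) interface, but
it could also turn arbitrarily in ambiguous situations … we obtain the same limit for all
choices", the metric (1); Theorem 1; §2 — `Ω^δ_ℂ` the polygonal domain, Thm. 3, Rem. 2, Thm. 4,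
Rem. 4; §3 — the proof of Thm. 1; and Chelkak–Smirnov, Invent. Math. 189 (2012), §2.2.1 — spins
free exactly on the inner vertices `Int Ω^δ`, `∓` imposed on the two boundary arcs, "if there
is a choice, the interface takes the left-most possible route"), finds:

* **Not a slice of the parent but its replacement.** The parent
  `convergesInLawToSLE_three_isingInterface` is the mis-stated transcription (free volume
  `Ω_δ ∖ meshBoundary`, thermal spins at the concave lattice corners which the interface
  predicate reads as frozen — §1 above; `isingZdDobrushinMeasure_eq_isingDobrushinMeasure` below
  records that the two measures coincide when `zdBoundary ⊆ meshBoundary`, in particular whenever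
  `Ω_δ` has no concave lattice corner). Neither statement is derived from the other in the tree;
  merging the corrected statement back into the parent's obligation would re-install the
  mis-stated form. The corrected statement is the apex of record for CDHKS Theorem 1 (spin
  half), exactly as `convergesInLawToSLE_sixteen_thirds_fkInterface` is for Theorem 2.
* **Model, domain, measure, curve space: faithful** — with the provisos already flagged (Jordan
  domains ⊂ bounded simply connected domains with degenerate prime ends; the canonical vertex set
  `meshDomain D δ` as the "reasonable approximation"; the `±` labels swapped, immaterial by the
  global spin flip and `orientChord`). The free volume `Ω_δ ∖ zdBoundary` is the one of
  Chelkak–Smirnov §2.2.1; the Hamiltonian of `isingMeasure` (Friedli–Velenik (3.6), weight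
  `exp (β ∑ σ_x σ_y)` over the edges touching the volume) puts the critical point at
  `criticalBetaTwo = log (1 + √2) / 2` as in CDHKS §1; `IsDiscretisation D E` is satisfiable
  (`UnitDiscDiscretisation.exists_isDiscretisation`), so the statement is not vacuous.
* **Selection rule: mis-cut, RESTATED (§4).** The child (like the parent) quantified over all
  interface-selection rules `IsInterfaceSelection` — wider than CDHKS's fixed rightmost/leftmost
  interface with arbitrary *local* turning; the printed proof is an exploration argument and the
  tree's own progress (`LeftmostInterface.lean`, `LeftmostInterfaceTightness.lean`) is about the
  leftmost exploration. The definition now fixes the leftmost interface (docstring of the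
  definition; §4). No other change of meaning.
* **Size XL; frontier.** The restated statement is a theorem modulo (i) tightness of the
  leftmost interface laws — PROVED from the FK-Ising RSW fact `fkIsing_rsw`
  (`LeftmostInterfaceTightness.exists_isTightMeasureSet_spinInterfaceLaw_leftmost`, through the
  Aizenman–Burchard criterion, the sector argument `SpinTraversalSectors.lean`, successive
  conditioning `IsingMultiCrossing.lean` and the band crossing bound `IsingBandCrossingBound.lean`:
  CDHKS §2 Thm. 3/Thm. 4/Rem. 4 for the leftmost interface) — and (ii) identification of the
  subsequential limits of the leftmost laws (CDHKS §3: Chelkak–Smirnov 2012, Thms 1.2, 5.6, Rem.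
  2.4, and Kemppainen–Smirnov 2017, Thm. 1.5 (ii)–(iii); implied by F2, and reduced by theorems
  only to its two printed inputs as hypotheses in `InterfaceSLELimitData.lean`,
  `isSLELaw_three_of_subseqLimit_spinInterface_of_limitData`, after `InterfaceSLEFrontier.lean`,
  `InterfaceSLECylinder.lean`, `InterfaceSLELocal.lean`, `InterfaceSLESource.lean`):
  `convergesInLawToSLE_three_isingInterface_zd_of_tight_of_ident`. Through the all-selection
  facts the older assemblies remain: F1 ⇐ (C1) `spinInterface_traversalBound`
  (`InterfaceSLETightness.lean`), F1 ∧ F2 ⟹ zd (`_of_facts`), (C1) ∧ F2 ⟹ zd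
  (`convergesInLawToSLE_three_isingInterface_zd_of_traversalBound'`, `InterfaceSLEIdentification.lean`).

## 4. The leftmost interface (CDHKS §1's standing choice)

CDHKS §1 (arXiv p. 3): "We assume `γ^δ` to be the rightmost (or the leftmost) interface, but it
could also turn arbitrarily in ambiguous situations with four alternating spins around a face. As
we obtain the same limit for all choices of `γ^δ`, the possible differences are only microscopic."
The printed proof (§2: tightness through the domain Markov property of the exploration, Rem. 2;
§3: the martingale property of the slit-domain observable for the exploration filtration) is an
argument about an *exploration* — the leftmost/rightmost interface, or any local turning rule —
and the tree follows it for the leftmost interface: `LeftmostInterface.lean` (`leftmostInterface`,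
the leftmost exploration of Chelkak–Smirnov 2012, §2.2.1, an `IsInterfaceSelection` for admissible
data) and `LeftmostInterfaceTightness.lean` (its Aizenman–Burchard bound and the tightness of its
laws from `fkIsing_rsw`; that file records that the all-interfaces form (C1) of the bound is not a
printed result). The section "The leftmost interface: transfer lemmas" isolates, as a THEOREM
whose hypotheses are the two halves of the proof for the leftmost interface only,
`convergesInLawToSLE_leftmostInterface_of_tight_of_ident` (tightness of the leftmost laws near
`δ = 0` ∧ identification of their subsequential limits ∧ uniqueness of the SLE law ⟹ convergence
of the leftmost interface to SLE₃; globally, `convergesInLawToSLE_three_isingInterface_zd_of_tight_of_ident`),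
and derives those hypotheses from the all-selection facts F1, F2 through a genuine selection rule
agreeing with the leftmost interface at every admissible mesh
(`exists_isInterfaceSelection_eq_leftmostInterface`; the two families of laws agree at all small
meshes): `exists_isTightMeasureSet_spinInterfaceLaw_leftmostInterface`,
`isSLELaw_three_of_subseqLimit_leftmostInterface`, `convergesInLawToSLE_leftmostInterface_of_facts`.
Dependents consume the corrected statement only through
`convergesInLawToSLE_three_isingInterface_zd.exists_convergesInLawToSLE` (`InterfaceSLEAssembly.lean`).

## Mathlib

Used, not redefined: `MeasureTheory.IsTightMeasureSet`, `isCompact_closure_of_isTightMeasureSet`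
(Prokhorov), `MeasureTheory.ProbabilityMeasure` with its topology of weak convergence and
`ProbabilityMeasure.tendsto_iff_forall_integral_tendsto`, `instMetrizableSpaceProbabilityMeasure`
(Lévy–Prokhorov), `Filter.tendsto_of_subseq_tendsto`, `IsCompact.tendsto_subseq`,
`MeasurableEmbedding.aemeasurable_map_iff`, `Measure.tilted` / `tilted_absolutelyContinuous`.
-/

noncomputable section

open MeasureTheory Filter Topology Set
open scoped NNReal ENNReal BoundedContinuousFunction
open Literature.Probability.LatticeModels Literature.Probability.Percolation

/-! ### Every map out of an Ising configuration space is a.e.-measurable -/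

namespace Literature.Probability.LatticeModels

/-- On a countable vertex set, the finite-volume Ising measure `μ_{Λ;β,h}^{bc}` is carried by the
(countable, hence measurable) range of the gluing map `τ ↦ glue Λ τ bc`, `τ : Λ → ℤˣ`, which is a
measurable embedding of a countable discrete space; consequently **every** map out of the
configuration space is a.e.-measurable for it (and `Measure.map` of interface curves carries no
junk). (Friedli–Velenik 2017, §3.1: `μ_{Λ;β,h}^η` is a probability measure on the finite set
`Ω_Λ^η`.) [cite: FriedliVelenik2017, §3.1] -/
theorem aemeasurable_isingMeasure {V : Type*} [DecidableEq V] [Countable V] (G : SimpleGraph V)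
    [G.LocallyFinite] (Λ : Finset V) (β h : ℝ) (bc : BoundaryCondition V) {X : Type*}
    [MeasurableSpace X] (f : SpinConfig V → X) : AEMeasurable f (isingMeasure G Λ β h bc) := by
  have hemb : MeasurableEmbedding (fun τ : Λ → ℤˣ => glue Λ τ bc) :=
    { injective := glue_injective Λ bc
      measurable := measurable_glue Λ bc
      measurableSet_image' := fun s _ => (s.to_countable.image _).measurableSet }
  have h1 : AEMeasurable f (isingRef Λ bc) := by
    unfold isingRef
    rw [hemb.aemeasurable_map_iff]
    exact (measurable_of_countable _).aemeasurable
  exact h1.mono_ac (tilted_absolutelyContinuous _ _)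

/-- The finite-volume Ising measure with boundary condition `fixed η` is carried by the
configurations that agree with `η` off the volume `Λ` (countable vertex set, so that the range
of the gluing map is a measurable set). (Friedli–Velenik 2017, §3.1, `Ω_Λ^η`.)
[cite: FriedliVelenik2017, §3.1] -/
theorem ae_isingMeasure_apply_eq_of_notMem {V : Type*} [DecidableEq V] [Countable V]
    (G : SimpleGraph V) [G.LocallyFinite] (Λ : Finset V) (β h : ℝ) (η : SpinConfig V) :
    ∀ᵐ σ ∂isingMeasure G Λ β h (.fixed η), ∀ x ∉ Λ, σ x = η x := by
  have hsub : ∀ σ ∈ Set.range (fun τ : Λ → ℤˣ => glue Λ τ (.fixed η)), ∀ x ∉ Λ, σ x = η x := by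
    rintro _ ⟨τ, rfl⟩ x hx
    simp [glue, hx]
  have hmeas : MeasurableSet (Set.range (fun τ : Λ → ℤˣ => glue Λ τ (.fixed η))) :=
    (Set.countable_range _).measurableSet
  have h1 : ∀ᵐ σ ∂isingRef Λ (.fixed η), σ ∈ Set.range (fun τ : Λ → ℤˣ => glue Λ τ (.fixed η)) := by
    unfold isingRef
    exact (ae_map_iff (measurable_glue Λ _).aemeasurable
      (p := fun σ => σ ∈ Set.range (fun τ : Λ → ℤˣ => glue Λ τ (.fixed η))) hmeas).2
      (ae_of_all _ fun τ => Set.mem_range_self τ)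
  have h2 : ∀ᵐ σ ∂isingMeasure G Λ β h (.fixed η),
      σ ∈ Set.range (fun τ : Λ → ℤˣ => glue Λ τ (.fixed η)) :=
    (tilted_absolutelyContinuous _ _).ae_le h1
  filter_upwards [h2] with σ hσ using hsub σ hσ

end Literature.Probability.LatticeModels

/-! ### Tightness plus identification of subsequential limits gives convergence -/

namespace Literature.Probability.LatticeModels

/-- **Assembly lemma (Prokhorov + subsequence principle).** Let `law δ`, `δ > 0`, be probability
measures on a separable metric (Borel) space such that the laws with `δ ∈ (0, δ₀]` form a tight
set, let `Q` be a property of probability measures with at most one witness, and assume that every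
weak limit of `law (u n)` along a sequence `u n → 0⁺` satisfies `Q`. Then there is a (unique) `ν`
with `Q ν` and `law δ → ν` weakly as `δ → 0⁺`. Proof: by Prokhorov's theorem (Mathlib
`isCompact_closure_of_isTightMeasureSet`) the closure of `{law δ : 0 < δ ≤ δ₀}` is compact, and the
space of probability measures is metrisable (Lévy–Prokhorov), so every sequence `u n → 0⁺` has a
subsequence along which `law` converges; its limit satisfies `Q`, hence is the same `ν` for all
subsequences, and `Filter.tendsto_of_subseq_tendsto` concludes. This is the standard last step of
CDHKS 2014, §3 ("for any subsequential limit … hence convergence"); Billingsley, *Convergence of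
probability measures* (2nd ed. 1999), Thm 5.1 and the corollary to Thm 5.1 (p. 59).
[cite: Billingsley1999, Thm 5.1 and Cor.] -/
theorem exists_tendsto_of_isTightMeasureSet {X : Type*} [MetricSpace X]
    [TopologicalSpace.SeparableSpace X] [MeasurableSpace X] [BorelSpace X]
    (law : ℝ → ProbabilityMeasure X) {δ₀ : ℝ} (hδ₀ : 0 < δ₀)
    (htight : IsTightMeasureSet {x | ∃ δ ∈ Set.Ioc 0 δ₀, (law δ : Measure X) = x})
    (Q : ProbabilityMeasure X → Prop)
    (hlim : ∀ u : ℕ → ℝ, Tendsto u atTop (𝓝[>] 0) →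
      ∀ ν, Tendsto (law ∘ u) atTop (𝓝 ν) → Q ν)
    (huniq : ∀ ν ν', Q ν → Q ν' → ν = ν') :
    ∃ ν, Q ν ∧ Tendsto law (𝓝[>] 0) (𝓝 ν) := by
  -- the compact set
  set S : Set (ProbabilityMeasure X) := law '' Set.Ioc 0 δ₀
  have hS : IsCompact (closure S) := by
    apply isCompact_closure_of_isTightMeasureSet
    refine htight.subset ?_
    rintro _ ⟨μ, ⟨δ, hδ, rfl⟩, rfl⟩
    exact ⟨δ, hδ, rfl⟩
  -- every sequence tending to `0⁺` has a subsequence along which `law` converges to a `Q`-measure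
  have key : ∀ u : ℕ → ℝ, Tendsto u atTop (𝓝[>] 0) →
      ∃ ν, Q ν ∧ ∃ φ : ℕ → ℕ, StrictMono φ ∧ Tendsto (law ∘ u ∘ φ) atTop (𝓝 ν) := by
    intro u hu
    have hu' := tendsto_nhdsWithin_iff.1 hu
    have hev : ∀ᶠ n in atTop, u n ∈ Set.Ioc (0 : ℝ) δ₀ := by
      filter_upwards [hu'.2, hu'.1.eventually (eventually_le_nhds hδ₀)] with n hn hn'
      exact ⟨hn, hn'⟩
    obtain ⟨N, hN⟩ := eventually_atTop.1 hev
    have hmem : ∀ k, (law ∘ u) (k + N) ∈ closure S := fun k =>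
      subset_closure ⟨u (k + N), hN _ (Nat.le_add_left N k), rfl⟩
    obtain ⟨ν, -, φ, hφ, hconv⟩ := hS.tendsto_subseq hmem
    have hψ : StrictMono fun k => φ k + N := fun a b hab => by simpa using hφ hab
    have hconv' : Tendsto (law ∘ u ∘ fun k => φ k + N) atTop (𝓝 ν) := by
      simpa [Function.comp_def] using hconv
    refine ⟨ν, ?_, fun k => φ k + N, hψ, hconv'⟩
    refine hlim (u ∘ fun k => φ k + N) (hu.comp hψ.tendsto_atTop) ν ?_
    simpa [Function.comp_def] using hconv'
  -- a witness, from the sequence `δ₀ / (n + 1)`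
  have hu₀ : Tendsto (fun n : ℕ => δ₀ / ((n : ℝ) + 1)) atTop (𝓝[>] 0) := by
    refine tendsto_nhdsWithin_iff.2 ⟨?_, Eventually.of_forall fun n => ?_⟩
    · exact tendsto_const_nhds.div_atTop (tendsto_natCast_atTop_atTop.atTop_add tendsto_const_nhds)
    · exact div_pos hδ₀ (Nat.cast_add_one_pos n)
  obtain ⟨ν, hν, -⟩ := key _ hu₀
  refine ⟨ν, hν, ?_⟩
  -- subsequence principle
  refine tendsto_of_subseq_tendsto fun u hu => ?_
  obtain ⟨ν', hν', φ, -, hconv⟩ := key u hu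
  obtain rfl := huniq ν ν' hν hν'
  exact ⟨φ, hconv⟩

/-- Integral form of `exists_tendsto_of_isTightMeasureSet` for random variables `Y δ` under
probability laws `P δ`: if the push-forward laws with `δ ∈ (0, δ₀]` are tight, every subsequential
limit law (in the sense of bounded continuous test functions) satisfies `Q`, and `Q` has at most one
witness, then the `Y δ` converge in law (`TendstoLaw`) as `δ → 0⁺` to any random variable `Z`
whose law satisfies `Q`, and such a law exists. (Billingsley 1999, Thm 5.1 and Cor.; Thm 2.1
(portmanteau) for the test-function form.) [cite: Billingsley1999, Thm 5.1 and Cor.] -/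
theorem exists_tendstoLaw_of_isTightMeasureSet {X : Type*} [MetricSpace X]
    [TopologicalSpace.SeparableSpace X] [MeasurableSpace X] [BorelSpace X]
    {Ωδ : ℝ → Type*} [∀ δ, MeasurableSpace (Ωδ δ)]
    {Y : ∀ δ, Ωδ δ → X} {P : ∀ δ, Measure (Ωδ δ)} [∀ δ, IsProbabilityMeasure (P δ)]
    (hY : ∀ δ, AEMeasurable (Y δ) (P δ)) {δ₀ : ℝ} (hδ₀ : 0 < δ₀)
    (htight : IsTightMeasureSet ((fun δ => (P δ).map (Y δ)) '' Set.Ioc 0 δ₀))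
    (Q : Measure X → Prop)
    (hlim : ∀ (u : ℕ → ℝ) (ν : Measure X), Tendsto u atTop (𝓝[>] 0) → IsProbabilityMeasure ν →
      (∀ f : X →ᵇ ℝ, Tendsto (fun n => ∫ ω, f (Y (u n) ω) ∂P (u n)) atTop (𝓝 (∫ x, f x ∂ν))) →
      Q ν)
    (huniq : ∀ ν ν', IsProbabilityMeasure ν → IsProbabilityMeasure ν' → Q ν → Q ν' → ν = ν') :
    ∃ ν : Measure X, IsProbabilityMeasure ν ∧ Q ν ∧
      ∀ {Ω' : Type*} [MeasurableSpace Ω'] (Z : Ω' → X) (P' : Measure Ω'),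
        AEMeasurable Z P' → P'.map Z = ν → RandomPlanarGeometry.TendstoLaw Y P Z P' := by
  set law : ℝ → ProbabilityMeasure X :=
    fun δ => ⟨(P δ).map (Y δ), Measure.isProbabilityMeasure_map (hY δ)⟩ with hlaw
  have hint : ∀ (δ : ℝ) (f : X →ᵇ ℝ), ∫ x, f x ∂(law δ : Measure X) = ∫ ω, f (Y δ ω) ∂P δ :=
    fun δ f => integral_map (hY δ) f.continuous.aestronglyMeasurable
  obtain ⟨ν, hQ, hT⟩ := exists_tendsto_of_isTightMeasureSet law hδ₀
    (by
      refine htight.subset ?_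
      rintro _ ⟨δ, hδ, rfl⟩
      exact ⟨δ, hδ, rfl⟩)
    (fun ν => Q ν)
    (by
      intro u hu ν hν
      refine hlim u ν hu inferInstance fun f => ?_
      have := (ProbabilityMeasure.tendsto_iff_forall_integral_tendsto.1 hν) f
      simpa [Function.comp_def, hint] using this)
    (fun ν ν' h h' => ProbabilityMeasure.toMeasure_injective
      (huniq _ _ inferInstance inferInstance h h'))
  refine ⟨ν, inferInstance, hQ, fun Z P' hZ hZν f => ?_⟩
  have := (ProbabilityMeasure.tendsto_iff_forall_integral_tendsto.1 hT) f
  simp only [hint] at this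
  rwa [← hZν, integral_map hZ f.continuous.aestronglyMeasurable] at this

end Literature.Probability.LatticeModels

namespace Literature.Probability.LatticeModels

/-! ### The Dobrushin Ising measure with the polygonal boundary frozen -/

/-- The free volume of the Dobrushin Ising model on the polygonal domain of `E = (Ω_δ; A, B)`:
the sites of `Ω_δ` off G02's square-lattice discrete boundary `E.zdBoundary` (vertices of the
topological boundary of the union of inner faces, together with the vertex boundary
`meshBoundary`), as a `Finset` (`meshDomainFinset`, empty junk for unbounded `Ω` or `δ ≤ 0`).
Compare `meshInteriorFinset Ω δ = Ω_δ ∖ meshBoundary Ω δ`, which still contains the concave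
lattice corners of `Ω_δ`. (CDHKS 2014, §1: spins on the vertices of `Ω^δ`, boundary conditions on
`∂Ω^δ`; §2: `Ω^δ_ℂ` the polygonal domain of `Ω^δ`.) [cite: CDHKSCRAS2014, §1–§2] -/
def zdInteriorFinset (E : DiscreteDobrushin) : Finset (Site 2) :=
  open scoped Classical in (meshDomainFinset E.Ω E.δ).filter (· ∉ E.zdBoundary)

/-- For bounded `Ω` and `δ > 0` the free volume is `Ω_δ ∖ zdBoundary`. (CDHKS 2014, §1.)
[cite: CDHKSCRAS2014, §1] -/
theorem coe_zdInteriorFinset {E : DiscreteDobrushin} (hΩ : Bornology.IsBounded E.Ω) (hδ : 0 < E.δ) :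
    (zdInteriorFinset E : Set (Site 2)) = meshDomain E.Ω E.δ \ E.zdBoundary := by
  classical
  ext x
  simp only [zdInteriorFinset, Finset.coe_filter, Set.mem_setOf_eq, Set.mem_sdiff,
    ← coe_meshDomainFinset hΩ hδ, Finset.mem_coe]

/-- The free volume lies in `Ω_δ`. (CDHKS 2014, §1.) [cite: CDHKSCRAS2014, §1] -/
theorem zdInteriorFinset_subset (E : DiscreteDobrushin) :
    zdInteriorFinset E ⊆ meshDomainFinset E.Ω E.δ := by
  classical
  exact Finset.filter_subset _ _

/-- The polygonal free volume `Ω_δ ∖ zdBoundary` is contained in the vertex-boundary free volume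
`Ω_δ ∖ meshBoundary` of `isingDobrushinMeasure` (`meshBoundary ⊆ zdBoundary`); the difference is
the set of concave lattice corners of `Ω_δ`. (CDHKS 2014, §1.) [cite: CDHKSCRAS2014, §1] -/
theorem zdInteriorFinset_subset_meshInteriorFinset (E : DiscreteDobrushin) :
    zdInteriorFinset E ⊆ meshInteriorFinset E.Ω E.δ := by
  classical
  by_cases h : Bornology.IsBounded E.Ω ∧ 0 < E.δ
  · intro x hx
    rw [← Finset.mem_coe, coe_zdInteriorFinset h.1 h.2] at hx
    rw [← Finset.mem_coe, coe_meshInteriorFinset h.1 h.2]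
    exact ⟨hx.1, fun hx' => hx.2 (E.meshBoundary_subset_zdBoundary hx')⟩
  · have h0 : meshDomainFinset E.Ω E.δ = ∅ := by
      unfold meshDomainFinset
      rw [dif_neg h]
    intro x hx
    exact absurd (h0 ▸ zdInteriorFinset_subset E hx) (Finset.notMem_empty x)

/-- A site of the polygonal boundary is not in the free volume. (CDHKS 2014, §1.)
[cite: CDHKSCRAS2014, §1] -/
theorem notMem_zdInteriorFinset_of_mem_zdBoundary {E : DiscreteDobrushin} {x : Site 2}
    (hx : x ∈ E.zdBoundary) : x ∉ zdInteriorFinset E := by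
  classical
  simp only [zdInteriorFinset, Finset.mem_filter, not_and, not_not]
  exact fun _ => hx

/-- **The Dobrushin Ising measure of the polygonal domain.** The Ising measure of the discrete
Dobrushin domain `E = (Ω_δ; A, B)` at inverse temperature `β`, zero field, in the volume
`Ω_δ ∖ zdBoundary` (`zdInteriorFinset`), all other spins frozen to `dobrushinBC E` (`+1` on the
discrete arc `zdArcA`, `−1` elsewhere, in particular on `zdArcB`); under `E.IsZdAdmissible` the
frozen part of `Ω_δ` is exactly `zdBoundary = zdArcA ⊔ zdArcB`, CDHKS's `±` Dobrushin boundary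
condition on `∂Ω^δ`. Differs from `isingDobrushinMeasure` (volume `Ω_δ ∖ meshBoundary`) exactly
at the concave lattice corners of `Ω_δ`, which are frozen here and free there. Junk for unbounded
`Ω` or `δ ≤ 0`: empty volume, Dirac mass at `dobrushinBC E`. (CDHKS 2014, §1 and Thm 1;
Friedli–Velenik 2017, §3.1 for `μ_{Λ;β,h}^η`.) [cite: CDHKSCRAS2014, §1 and Thm. 1] -/
def isingZdDobrushinMeasure (E : DiscreteDobrushin) (β : ℝ) : Measure (SpinConfig (Site 2)) :=
  isingMeasure (discreteDomainGraph E.Ω E.δ) (zdInteriorFinset E) β 0 (.fixed (dobrushinBC E))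

/-- The polygonal Dobrushin Ising measure is a probability measure.
(Friedli–Velenik 2017, §3.1.) [cite: FriedliVelenik2017, §3.1] -/
instance isingZdDobrushinMeasure.instIsProbabilityMeasure (E : DiscreteDobrushin) (β : ℝ) :
    IsProbabilityMeasure (isingZdDobrushinMeasure E β) := by
  unfold isingZdDobrushinMeasure; infer_instance

/-- Every map out of the configuration space (in particular every interface-curve map, for every
selection rule) is a.e.-measurable for the polygonal Dobrushin Ising measure.
(Friedli–Velenik 2017, §3.1.) [cite: FriedliVelenik2017, §3.1] -/
theorem aemeasurable_isingZdDobrushinMeasure (E : DiscreteDobrushin) (β : ℝ) {X : Type*}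
    [MeasurableSpace X] (f : SpinConfig (Site 2) → X) :
    AEMeasurable f (isingZdDobrushinMeasure E β) :=
  aemeasurable_isingMeasure _ _ _ _ _ f

/-- The polygonal Dobrushin Ising measure is carried by the configurations equal to the boundary
spins `dobrushinBC E` off the free volume. (Friedli–Velenik 2017, §3.1.)
[cite: FriedliVelenik2017, §3.1] -/
theorem ae_isingZdDobrushinMeasure_eq_dobrushinBC (E : DiscreteDobrushin) (β : ℝ) :
    ∀ᵐ σ ∂isingZdDobrushinMeasure E β, ∀ x ∉ zdInteriorFinset E, σ x = dobrushinBC E x :=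
  ae_isingMeasure_apply_eq_of_notMem _ _ _ _ _

/-- **Consistency of the frozen spins with the interface predicate.** For a
configuration `σ` carrying the boundary spins `dobrushinBC E` off the free volume
`Ω_δ ∖ zdBoundary` (almost every `σ`, `ae_isingZdDobrushinMeasure_eq_dobrushinBC`), G02's
`±`-completed predicate `E.IsPlus σ x` is literally `σ x = 1`, at every site. (This fails for the
volume `Ω_δ ∖ meshBoundary` of `isingDobrushinMeasure` at concave lattice corners.)
(CDHKS 2014, §1: the interface has spins `+1` on its left and `−1` on its right.)
[cite: CDHKSCRAS2014, §1] -/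
theorem isPlus_iff_eq_one {E : DiscreteDobrushin} {σ : SpinConfig (Site 2)}
    (hσ : ∀ x ∉ zdInteriorFinset E, σ x = dobrushinBC E x) (x : Site 2) :
    E.IsPlus σ x ↔ σ x = 1 := by
  by_cases hA : x ∈ E.zdArcA
  · have hx : σ x = 1 := by
      rw [hσ x (notMem_zdInteriorFinset_of_mem_zdBoundary (E.zdArcA_subset_zdBoundary hA))]
      exact dobrushinBC_of_mem hA
    exact ⟨fun _ => hx, fun _ => Or.inl hA⟩
  · by_cases hB : x ∈ E.zdArcB
    · have hx : σ x = -1 := by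
        rw [hσ x (notMem_zdInteriorFinset_of_mem_zdBoundary (E.zdArcB_subset_zdBoundary hB))]
        exact dobrushinBC_of_not_mem hA
      constructor
      · rintro (h | ⟨h, -⟩)
        · exact absurd h hA
        · exact absurd hB h
      · intro h
        rw [hx] at h
        exact absurd h (by decide)
    · exact ⟨fun h => h.elim (fun h => absurd h hA) And.right, fun h => Or.inr ⟨hB, h⟩⟩

/-- Companion of `isPlus_iff_eq_one`: on the support of the polygonal Dobrushin measure,
`E.IsMinus σ x` is literally `σ x = -1`. (CDHKS 2014, §1.) [cite: CDHKSCRAS2014, §1] -/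
theorem isMinus_iff_eq_neg_one {E : DiscreteDobrushin}
    {σ : SpinConfig (Site 2)} (hσ : ∀ x ∉ zdInteriorFinset E, σ x = dobrushinBC E x) (x : Site 2) :
    E.IsMinus σ x ↔ σ x = -1 := by
  have h1 := E.isPlus_iff_not_isMinus σ x
  rw [isPlus_iff_eq_one hσ x] at h1
  rcases Int.units_eq_one_or (σ x) with h | h
  · simp only [h, true_iff] at h1
    simpa [h] using h1
  · simp only [h, show ((-1 : ℤˣ) = 1) ↔ False by decide, false_iff, not_not] at h1
    simpa [h] using h1

/-- The law of the selected spin interface at mesh `δ`: push-forward of the critical polygonal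
Dobrushin Ising measure of `E δ` under `σ ↦ spinInterfaceCurve D δ (sel δ σ)` (a genuine
push-forward: every map is a.e.-measurable, `aemeasurable_isingZdDobrushinMeasure`).
(CDHKS 2014, §1: "the law of `γ^δ`".) [cite: CDHKSCRAS2014, §1 and Thm. 1] -/
def spinInterfaceLaw (D : RandomPlanarGeometry.DobrushinDomain) (E : ℝ → DiscreteDobrushin)
    (sel : ℝ → SpinConfig (Site 2) → List (Sym2 (Site 2))) (δ : ℝ) : Measure (RandomPlanarGeometry.CurveClass ℂ) :=
  (isingZdDobrushinMeasure (E δ) criticalBetaTwo).map fun σ => spinInterfaceCurve D δ (sel δ σ)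

/-- The interface law is a probability measure. (CDHKS 2014, §1.) [cite: CDHKSCRAS2014, §1] -/
instance spinInterfaceLaw.instIsProbabilityMeasure (D : RandomPlanarGeometry.DobrushinDomain) (E : ℝ → DiscreteDobrushin)
    (sel : ℝ → SpinConfig (Site 2) → List (Sym2 (Site 2))) (δ : ℝ) :
    IsProbabilityMeasure (spinInterfaceLaw D E sel δ) :=
  Measure.isProbabilityMeasure_map (aemeasurable_isingZdDobrushinMeasure _ _ _)

/-! ### crit-ising.S17, corrected transcription -/

/-- **Spin-Ising interfaces converge to SLE₃** (transcription of the statement recorded as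
crit-ising.S17; Chelkak–Duminil-Copin–Hongler–Kemppainen–Smirnov, C. R. Math. Acad. Sci. Paris
352 (2014) 157, Theorem 1, for the interface fixed in its §1: "We assume `γ^δ` to be the
rightmost (or the leftmost) interface"). Let `(D; a, b)` be a Jordan domain with two marked
boundary points and let `(Ω_δ; a_δ, b_δ) = E δ` be admissible square-lattice Dobrushin
discretisations of it (`IsDiscretisation D E`). Consider the critical Ising model
(`β = β_c = ½ log (1 + √2)`, `h = 0`) on `Ω_δ` with Dobrushin boundary conditions imposed on the
whole polygonal boundary `zdBoundary = zdArcA ⊔ zdArcB` of `Ω_δ`: `+` on the discrete arc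
`(a_δ b_δ)`, `−` on `(b_δ a_δ)` (`isingZdDobrushinMeasure`; CDHKS print the labels the other way
round, `−1` on `(a^δ b^δ)` and `+1` on `(b^δ a^δ)`, which the global spin flip at `h = 0` makes
immaterial for the law of the `a → b` interface), and let `γ^δ` be the **leftmost interface**
`leftmostInterface (E δ) σ` of `LeftmostInterface.lean`: the domain wall explored from one `A`–`B`
boundary edge to the other keeping `+` on its left and leaving every face through the leftmost
domain-wall exit (Chelkak–Smirnov, Invent. Math. 189 (2012), §2.2.1: "if there is a choice, the
interface takes the left-most possible route"; according to the orientation of `∂D` and the label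
flip this is CDHKS's leftmost or rightmost interface, both of which they allow), a Dobrushin
interface of `σ` for admissible data (`isDobrushinInterface_leftmostInterface`). Then `γ^δ`, as a
random curve modulo reparametrisation oriented from `a` to `b` (`spinInterfaceCurve`), converges
in law to chordal SLE₃ in `D` from `a` to `b` as `δ → 0⁺`.
**Restated 2026-08-15 (review of the split, D-0026/D-0027): the selection rule.** Until then this
definition, like its parent `convergesInLawToSLE_three_isingInterface`, quantified over *all*
interface-selection rules `sel δ` with `IsInterfaceSelection (E δ) (sel δ)` — any map choosing
some Dobrushin interface of each configuration, possibly by a configuration-dependent global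
choice — flagged as "a mild strengthening". That form is wider than the source: CDHKS fix the
rightmost/leftmost interface and remark that `γ^δ` "could also turn arbitrarily in ambiguous
situations with four alternating spins around a face. As we obtain the same limit for all
choices of `γ^δ`, the possible differences are only microscopic" (§1, arXiv p. 3) — a remark
about the turning rule of the exploration; the printed proof (§2: Condition G in the slit domains
through the domain Markov property, Rem. 2; §3: the martingale property of the slit-domain
fermionic observable for the exploration filtration) is an argument about an exploration and
does not address global choices among all Dobrushin interfaces, and the tree's proof effort is
accordingly about the leftmost exploration (`LeftmostInterfaceTightness.lean`, which proves its
Aizenman–Burchard bound and the tightness of its laws from `fkIsing_rsw` and records that the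
all-interfaces bound (C1) `spinInterface_traversalBound` "is not a printed result"; likewise the
docstring of F2 below). A Literature fact is never stated stronger than its source, so the
statement now fixes the leftmost interface. The all-selection facts F1
`isTightMeasureSet_spinInterfaceLaw`, F2 `isSLELaw_three_of_subseqLimit_spinInterface` (below) and
(C1) (`InterfaceSLETightness.lean`) are left untouched (they have dependents and seats of their
own); they imply the present statement (`convergesInLawToSLE_three_isingInterface_zd_of_facts`,
through a genuine selection rule agreeing with the leftmost interface at admissible meshes), as do
the leftmost-only hypotheses of `convergesInLawToSLE_three_isingInterface_zd_of_tight_of_ident`,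
whose tightness half is a theorem modulo `fkIsing_rsw`
(`exists_isTightMeasureSet_spinInterfaceLaw_leftmost`, `LeftmostInterfaceTightness.lean`). The
docstrings of the sibling files `InterfaceSLE{Tightness,Identification,Assembly,Frontier,Cylinder,
Local,LimitData,Source}.lean` predate the restatement and describe the all-selection form; their
theorems concluding this statement are unaffected (they factor through `_of_facts`).
TODO(general form): the rightmost interface (mirror image) and arbitrary *local* turning rules,
for which CDHKS assert the same limit; the tree has only the leftmost exploration.
**Discrepancy with `convergesInLawToSLE_three_isingInterface`, the volume** (same cite): that
statement uses `isingDobrushinMeasure`, whose free volume `Ω_δ ∖ meshBoundary` contains the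
concave lattice corners of `Ω_δ`, sites which the interface predicates `IsDobrushinInterface` /
`leftmostInterface` treat as frozen boundary spins (`zdArcA ⊔ zdArcB = zdBoundary ⊋ meshBoundary`
under admissibility); the curve it speaks about is thus not an interface of the sampled
configuration (thermal corner spins are overridden), which is not the printed theorem. This
definition uses the volume the predicates presuppose (see the module docstring, §1). *Flag kept
from the original:* Jordan domains are a special case of CDHKS's bounded simply connected domains
with degenerate prime ends. Named fact; reduced to `isTightMeasureSet_spinInterfaceLaw` and
`isSLELaw_three_of_subseqLimit_spinInterface` by `convergesInLawToSLE_three_isingInterface_zd_of_facts`.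
[cite: CDHKSCRAS2014, Thm. 1] -/
def convergesInLawToSLE_three_isingInterface_zd : Prop :=
  ∀ (D : RandomPlanarGeometry.DobrushinDomain) (E : ℝ → DiscreteDobrushin) (_hE : IsDiscretisation D E),
    RandomPlanarGeometry.ConvergesInLawToSLE 3 D (Ωδ := fun _ => SpinConfig (Site 2))
      (fun δ σ => spinInterfaceCurve D δ (leftmostInterface (E δ) σ))
      (fun δ => isingZdDobrushinMeasure (E δ) criticalBetaTwo)

/-! ### Existence of Dobrushin interfaces (implicit in CDHKS §1) -/

/-- **Every configuration of an admissible domain has a Dobrushin interface.** For admissible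
square-lattice Dobrushin data `E` (`IsZdAdmissible`) and every spin configuration `σ` there is a
list of dual edges `γ` with `IsDobrushinInterface E σ γ` — so that interface-selection rules
(`IsInterfaceSelection`) are constrained on every configuration, which the tightness and
identification facts below take for granted. CDHKS 2014, §1: "These boundary conditions generate
a spin interface `γ^δ` … running from `a^δ` to `b^δ` that has spins `+1` on its left side and
`−1` on its right". Proof sketch (finite combinatorics, no planar topology needed): explore from
an `A`–`B` edge through inner faces keeping `IsPlus` on the left and `IsMinus` on the right with a
fixed turning rule at faces with four alternating spins; at an inner face entered by a valid dart
a valid exit side always exists (case analysis on the two far corners), an exit into a non-inner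
face crosses a face-boundary edge whose endpoints lie on the arcs, hence an `A`–`B` edge; the
dart dynamics is injective, so no dart — and no dual edge — repeats and the finite exploration
must leave through the other `A`–`B` edge; if neither `A`–`B` edge could be entered with `A` on
the left, the mirror exploration (keeping `−` on the left) started at one of them would have to
leave through the other with `B` on its left, exhibiting a valid entrance. Named fact (the Ising
analogue of G02's `existsUnique_medialExploration`; uniqueness fails at alternating faces).
[cite: CDHKSCRAS2014, §1] -/
def exists_isDobrushinInterface : Prop :=
  ∀ (E : DiscreteDobrushin) (_hE : E.IsZdAdmissible) (σ : SpinConfig (Site 2)),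
    ∃ γ, IsDobrushinInterface E σ γ

/-- Under `exists_isDobrushinInterface` (hypothesis `hex`), a selection rule of an admissible
domain selects a genuine Dobrushin interface of every configuration. (CDHKS 2014, §1.)
[cite: CDHKSCRAS2014, §1] -/
theorem isDobrushinInterface_sel (hex : exists_isDobrushinInterface)
    {E : DiscreteDobrushin} (hE : E.IsZdAdmissible)
    {sel : SpinConfig (Site 2) → List (Sym2 (Site 2))} (hsel : IsInterfaceSelection E sel)
    (σ : SpinConfig (Site 2)) : IsDobrushinInterface E σ (sel σ) :=
  hsel σ (hex E hE σ)

/-! ### The two halves of CDHKS's proof, as named facts -/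

/-- **CDHKS 2014, §2 (tightness of critical spin-Ising interfaces).** For a Jordan domain
`(D; a, b)`, admissible discretisations `E δ` (`IsDiscretisation D E`) and any interface-selection
rules `sel δ`, the laws of the critical spin-Ising Dobrushin interfaces `γ^δ`
(`spinInterfaceLaw D E sel δ`) with `0 < δ ≤ δ₀` form, for some `δ₀ > 0`, a tight set of measures
on the space `CurveClass ℂ` of curves modulo reparametrisation (Mathlib `IsTightMeasureSet`).
CDHKS, Thm 3 (= Kemppainen–Smirnov, *Random curves, scaling limits and Loewner evolutions*,
arXiv:1212.6215, Thm 1.3: Condition G ⇒ the family `{γ^δ}` is tight), with Condition G for the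
interfaces supplied in §2 by Thm 4 (= Chelkak–Duminil-Copin–Hongler, arXiv:1312.7785, Thm 1.1:
FK-Ising crossing bounds in topological rectangles, uniform in the boundary conditions) and
Remark 4 (the spin case via the Edwards–Sokal coupling and FKG monotonicity, CDCH Cor. 1.7),
using the domain Markov property to reduce to time zero (Remark 2); for selection rules other
than the leftmost/rightmost (or locally decided) interface this rests on CDHKS's assertion "we
obtain the same limit for all choices of `γ^δ`, the possible differences are only microscopic"
(§1). The restriction to small `δ` is forced by the transcription: for `δ` so large that `E δ` is
not admissible the selection rule, hence the law, is unconstrained. Relies on the existence of a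
Dobrushin interface for every configuration of an admissible domain (`exists_isDobrushinInterface`,
implicit in CDHKS §1). Named fact (a theory: KS 2017 and CDCH 2016).
[cite: CDHKSCRAS2014, Thm. 3 and §2] -/
def isTightMeasureSet_spinInterfaceLaw : Prop :=
  ∀ (D : RandomPlanarGeometry.DobrushinDomain) (E : ℝ → DiscreteDobrushin) (_hE : IsDiscretisation D E)
    (sel : ℝ → SpinConfig (Site 2) → List (Sym2 (Site 2)))
    (_hsel : ∀ δ, IsInterfaceSelection (E δ) (sel δ)),
    ∃ δ₀ > 0, IsTightMeasureSet (spinInterfaceLaw D E sel '' Set.Ioc 0 δ₀)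

/-- **CDHKS 2014, §3 (identification of subsequential limits).** In the setting of
`isTightMeasureSet_spinInterfaceLaw`, if along a sequence of meshes `δ_n → 0⁺` the interface laws
converge weakly (against bounded continuous test functions) to a probability measure `ν` on
`CurveClass ℂ`, then `ν` is the law of chordal SLE₃ in `(D; a, b)` (`IsSLELaw 3 D ν`). CDHKS,
proof of Thm 1 (§3): with conformal maps `φ^δ → φ` and `w = Φ ∘ φ`, the spin fermionic observable
`F^δ_n` in the slit domains is uniformly close to `M^δ_t(z) = (∂_z[-G^δ_t(w^δ(z))⁻¹])^{1/2}`
(Chelkak–Smirnov, Invent. Math. 189 (2012), Thms 1.2 and 5.6); `F^δ_n(z^δ)` is a martingale for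
the exploration filtration; by Thm 3 (KS) the subsequential limit is described by a Loewner chain
with continuous driving process `W` having finite exponential moments, so `M_t(z)`, `t ≤ T(z)`, is
a martingale; expanding at `w → ∞` shows that `W_t` and `W_t² - 3t` are martingales, and Lévy's
characterisation gives `W = √3 B`. The martingale argument is printed for the leftmost/rightmost
(or any locally decided) interface, for which the exploration has the domain Markov property; for
general selection rules the fact rests on CDHKS's assertion "we obtain the same limit for all
choices of `γ^δ`" (§1). In H21's encoding `IsSLELaw 3 D ν` moreover packages the transport of
SLE₃ from `(ℍ; 0, ∞)` to `(D; a, b)` by a chordal uniformizing map (CDHKS p. 158: SLE "defined in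
all other simply connected domains via conformal maps") and presupposes the SLE₃ trace on the
canonical space (Rohde–Schramm 2005, Thm 5.1), so that together with
`isTightMeasureSet_spinInterfaceLaw` this fact entails `exists_isSLECurve` for `κ = 3`. Named
fact (a theory: CS 2012, KS 2017, stochastic calculus).
[cite: CDHKSCRAS2014, §3 (proof of Thm. 1)] -/
def isSLELaw_three_of_subseqLimit_spinInterface : Prop :=
  ∀ (D : RandomPlanarGeometry.DobrushinDomain) (E : ℝ → DiscreteDobrushin) (_hE : IsDiscretisation D E)
    (sel : ℝ → SpinConfig (Site 2) → List (Sym2 (Site 2)))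
    (_hsel : ∀ δ, IsInterfaceSelection (E δ) (sel δ))
    (u : ℕ → ℝ) (_hu : Tendsto u atTop (𝓝[>] 0))
    (ν : Measure (RandomPlanarGeometry.CurveClass ℂ)) [IsProbabilityMeasure ν],
    (∀ f : RandomPlanarGeometry.CurveClass ℂ →ᵇ ℝ,
      Tendsto (fun n => ∫ c, f c ∂spinInterfaceLaw D E sel (u n)) atTop (𝓝 (∫ c, f c ∂ν))) →
    RandomPlanarGeometry.IsSLELaw 3 D ν

/-! ### The leftmost interface: transfer lemmas -/

/-- **A genuine selection rule agreeing with the leftmost interface at admissible meshes.** For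
every family of discrete Dobrushin data there are interface-selection rules `sel δ`
(`IsInterfaceSelection (E δ) (sel δ)` for *every* `δ`) with `sel δ = leftmostInterface (E δ)`
whenever `E δ` is admissible (there the leftmost exploration selects a Dobrushin interface,
`isInterfaceSelection_leftmostInterface`; at the other meshes choose any interface when one
exists). Device for feeding the leftmost interface of CDHKS §1 ("We assume `γ^δ` to be the
rightmost (or the leftmost) interface") to statements quantified over selection rules.
[cite: CDHKSCRAS2014, §1] -/
theorem exists_isInterfaceSelection_eq_leftmostInterface (E : ℝ → DiscreteDobrushin) :
    ∃ sel : ℝ → SpinConfig (Site 2) → List (Sym2 (Site 2)),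
      (∀ δ, IsInterfaceSelection (E δ) (sel δ)) ∧
      ∀ δ, (E δ).IsZdAdmissible → sel δ = leftmostInterface (E δ) := by
  classical
  have key : ∀ δ, ∃ s : SpinConfig (Site 2) → List (Sym2 (Site 2)),
      IsInterfaceSelection (E δ) s ∧ ((E δ).IsZdAdmissible → s = leftmostInterface (E δ)) := by
    intro δ
    by_cases h : (E δ).IsZdAdmissible
    · exact ⟨_, isInterfaceSelection_leftmostInterface h, fun _ => rfl⟩
    · refine ⟨fun σ => if hσ : ∃ γ, IsDobrushinInterface (E δ) σ γ then hσ.choose else [],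
        fun σ hσ => ?_, fun h' => absurd h' h⟩
      simp only [dif_pos hσ]
      exact hσ.choose_spec
  choose sel hsel hleft using key
  exact ⟨sel, hsel, hleft⟩

/-- The interface law at mesh `δ` only depends on the selection rule at mesh `δ`. [folklore] -/
theorem spinInterfaceLaw_congr (D : RandomPlanarGeometry.DobrushinDomain) (E : ℝ → DiscreteDobrushin)
    {sel sel' : ℝ → SpinConfig (Site 2) → List (Sym2 (Site 2))} {δ : ℝ} (h : sel δ = sel' δ) :
    spinInterfaceLaw D E sel δ = spinInterfaceLaw D E sel' δ := by
  simp only [spinInterfaceLaw, h]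

/-- **F1 for the leftmost interface.** The tightness fact `isTightMeasureSet_spinInterfaceLaw`
(CDHKS §2, all selection rules) yields the tightness of the laws of the leftmost interface near
`δ = 0`: apply it to a selection rule agreeing with the leftmost interface at admissible meshes
(`exists_isInterfaceSelection_eq_leftmostInterface`) and shrink `δ₀` below the admissibility
threshold of the discretisation, where the two families of laws coincide. (The same tightness is
proved outright from `fkIsing_rsw` in `LeftmostInterfaceTightness.lean`,
`exists_isTightMeasureSet_spinInterfaceLaw_leftmost`.) [cite: CDHKSCRAS2014, §2 Thm. 3] -/
theorem exists_isTightMeasureSet_spinInterfaceLaw_leftmostInterface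
    (h₁ : isTightMeasureSet_spinInterfaceLaw)
    {D : RandomPlanarGeometry.DobrushinDomain} {E : ℝ → DiscreteDobrushin} (hE : IsDiscretisation D E) :
    ∃ δ₀ > 0, IsTightMeasureSet
      (spinInterfaceLaw D E (fun δ => leftmostInterface (E δ)) '' Set.Ioc 0 δ₀) := by
  obtain ⟨sel, hsel, hleft⟩ := exists_isInterfaceSelection_eq_leftmostInterface E
  obtain ⟨δ₀, hδ₀, htight⟩ := h₁ D E hE sel hsel
  obtain ⟨δ₁, hδ₁, hadm⟩ : ∃ δ₁ > 0, ∀ δ, 0 < δ → δ < δ₁ → (E δ).IsZdAdmissible := by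
    have h := hE.eventually_isZdAdmissible
    rw [eventually_nhdsWithin_iff, Metric.eventually_nhds_iff] at h
    obtain ⟨ε, hε, h⟩ := h
    refine ⟨ε, hε, fun δ hδ hδε => h ?_ hδ⟩
    rwa [Real.dist_eq, sub_zero, abs_of_pos hδ]
  refine ⟨min δ₀ (δ₁ / 2), lt_min hδ₀ (half_pos hδ₁), htight.subset ?_⟩
  rintro _ ⟨δ, hδ, rfl⟩
  have hδ' : δ < δ₁ := hδ.2.trans_lt ((min_le_right _ _).trans_lt (half_lt_self hδ₁))
  exact ⟨δ, ⟨hδ.1, hδ.2.trans (min_le_left _ _)⟩,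
    spinInterfaceLaw_congr D E (hleft δ (hadm δ hδ.1 hδ'))⟩

/-- **F2 for the leftmost interface.** The identification fact
`isSLELaw_three_of_subseqLimit_spinInterface` (CDHKS §3, all selection rules) yields: every weak
subsequential limit, along meshes `u n → 0⁺`, of the laws of the *leftmost* interface is the chordal
SLE₃ law in `(D; a, b)` — along the sequence the data are eventually admissible
(`IsDiscretisation.eventually_isZdAdmissible`), so the leftmost laws eventually coincide with those
of a genuine selection rule (`exists_isInterfaceSelection_eq_leftmostInterface`), to which F2
applies. This is the printed setting of CDHKS §3 (the martingale property of the slit-domain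
observable for the exploration filtration). [cite: CDHKSCRAS2014, §3 (proof of Thm. 1)] -/
theorem isSLELaw_three_of_subseqLimit_leftmostInterface
    (h₂ : isSLELaw_three_of_subseqLimit_spinInterface)
    {D : RandomPlanarGeometry.DobrushinDomain} {E : ℝ → DiscreteDobrushin} (hE : IsDiscretisation D E)
    {u : ℕ → ℝ} (hu : Tendsto u atTop (𝓝[>] 0))
    (ν : Measure (RandomPlanarGeometry.CurveClass ℂ)) [IsProbabilityMeasure ν]
    (hlim : ∀ f : RandomPlanarGeometry.CurveClass ℂ →ᵇ ℝ,
      Tendsto (fun n => ∫ c, f c ∂spinInterfaceLaw D E (fun δ => leftmostInterface (E δ)) (u n))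
        atTop (𝓝 (∫ c, f c ∂ν))) :
    RandomPlanarGeometry.IsSLELaw 3 D ν := by
  obtain ⟨sel, hsel, hleft⟩ := exists_isInterfaceSelection_eq_leftmostInterface E
  refine h₂ D E hE sel hsel u hu ν fun f => (hlim f).congr' ?_
  filter_upwards [hu.eventually hE.eventually_isZdAdmissible] with n hn
  rw [spinInterfaceLaw_congr D E (sel := sel) (sel' := fun δ => leftmostInterface (E δ)) (hleft _ hn)]

/-- **Convergence of the leftmost interface to SLE₃ from the two halves of CDHKS's proof, as
hypotheses about the leftmost interface only** (CDHKS 2014, Thm. 1 for the interface of §1: "We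
assume `γ^δ` to be the rightmost (or the leftmost) interface"): if the laws of the leftmost
critical spin-Ising Dobrushin interfaces of a family of discrete Dobrushin data `E δ` of `(D; a, b)`
are tight for `δ ∈ (0, δ₀]` (CDHKS §2) and every weak subsequential limit of them along meshes
`u n → 0⁺` is the chordal SLE₃ law (CDHKS §3), then, SLE laws being unique (`IsSLECurve.map_eq`),
the leftmost interface converges in law to chordal SLE₃ in `D` from `a` to `b` as `δ → 0⁺`
(Prokhorov and the subsequence principle, `exists_tendstoLaw_of_isTightMeasureSet`; the
measurability clause of `ConvergesInLawToSLE` is automatic, `aemeasurable_isingZdDobrushinMeasure`).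
PROVED. [cite: CDHKSCRAS2014, Thm. 1 and §3] -/
theorem convergesInLawToSLE_leftmostInterface_of_tight_of_ident
    {D : RandomPlanarGeometry.DobrushinDomain} {E : ℝ → DiscreteDobrushin}
    (htight : ∃ δ₀ > 0, IsTightMeasureSet
      (spinInterfaceLaw D E (fun δ => leftmostInterface (E δ)) '' Set.Ioc 0 δ₀))
    (hident : ∀ (u : ℕ → ℝ), Tendsto u atTop (𝓝[>] 0) →
      ∀ (ν : Measure (RandomPlanarGeometry.CurveClass ℂ)) [IsProbabilityMeasure ν],
        (∀ f : RandomPlanarGeometry.CurveClass ℂ →ᵇ ℝ,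
          Tendsto (fun n => ∫ c, f c ∂spinInterfaceLaw D E (fun δ => leftmostInterface (E δ)) (u n))
            atTop (𝓝 (∫ c, f c ∂ν))) →
        RandomPlanarGeometry.IsSLELaw 3 D ν)
    (huniq : RandomPlanarGeometry.IsSLECurve.map_eq) :
    RandomPlanarGeometry.ConvergesInLawToSLE 3 D (Ωδ := fun _ => SpinConfig (Site 2))
      (fun δ σ => spinInterfaceCurve D δ (leftmostInterface (E δ) σ))
      (fun δ => isingZdDobrushinMeasure (E δ) criticalBetaTwo) := by
  have hY : ∀ δ, AEMeasurable (fun σ => spinInterfaceCurve D δ (leftmostInterface (E δ) σ))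
      (isingZdDobrushinMeasure (E δ) criticalBetaTwo) :=
    fun δ => aemeasurable_isingZdDobrushinMeasure _ _ _
  obtain ⟨δ₀, hδ₀, htight⟩ := htight
  obtain ⟨ν, hν, hQ, hT⟩ := exists_tendstoLaw_of_isTightMeasureSet
    (Ωδ := fun _ => SpinConfig (Site 2))
    (P := fun δ => isingZdDobrushinMeasure (E δ) criticalBetaTwo)
    hY hδ₀ htight (fun ν => RandomPlanarGeometry.IsSLELaw 3 D ν)
    (fun u ν hu hν hf => by
      haveI := hν
      refine hident u hu ν fun f => ?_
      simpa only [spinInterfaceLaw, integral_map (hY _) f.continuous.aestronglyMeasurable]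
        using hf f)
    (fun ν ν' _ _ h h' => RandomPlanarGeometry.IsSLELaw.unique huniq h h')
  obtain ⟨Γ, hΓ, rfl⟩ := hQ
  exact ⟨Γ, hΓ, Eventually.of_forall hY, hT Γ Process.preWienerMeasure hΓ.aemeasurable rfl⟩

/-- **F1 ∧ F2 ∧ uniqueness ⟹ the leftmost interface converges to SLE₃** on every discretised
Dobrushin domain (`convergesInLawToSLE_leftmostInterface_of_tight_of_ident` fed with
`exists_isTightMeasureSet_spinInterfaceLaw_leftmostInterface` and
`isSLELaw_three_of_subseqLimit_leftmostInterface`). PROVED. [cite: CDHKSCRAS2014, Thm. 1] -/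
theorem convergesInLawToSLE_leftmostInterface_of_facts
    (h₁ : isTightMeasureSet_spinInterfaceLaw) (h₂ : isSLELaw_three_of_subseqLimit_spinInterface)
    (huniq : RandomPlanarGeometry.IsSLECurve.map_eq)
    {D : RandomPlanarGeometry.DobrushinDomain} {E : ℝ → DiscreteDobrushin} (hE : IsDiscretisation D E) :
    RandomPlanarGeometry.ConvergesInLawToSLE 3 D (Ωδ := fun _ => SpinConfig (Site 2))
      (fun δ σ => spinInterfaceCurve D δ (leftmostInterface (E δ) σ))
      (fun δ => isingZdDobrushinMeasure (E δ) criticalBetaTwo) :=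
  convergesInLawToSLE_leftmostInterface_of_tight_of_ident
    (exists_isTightMeasureSet_spinInterfaceLaw_leftmostInterface h₁ hE)
    (fun _u hu ν _ hlim => isSLELaw_three_of_subseqLimit_leftmostInterface h₂ hE hu ν hlim) huniq

/-- **The corrected statement exhibits, on every discretised Dobrushin domain, a family of
interface curves converging in law to SLE₃** (the leftmost interfaces). Dependents consume the
statement only in this form (`InterfaceSLEAssembly.lean`: existence and transience of the SLE₃
trace), which insulates them from its binder structure. [cite: CDHKSCRAS2014, Thm. 1] -/
theorem convergesInLawToSLE_three_isingInterface_zd.exists_convergesInLawToSLE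
    (h : convergesInLawToSLE_three_isingInterface_zd)
    {D : RandomPlanarGeometry.DobrushinDomain} {E : ℝ → DiscreteDobrushin} (hE : IsDiscretisation D E) :
    ∃ X : ℝ → SpinConfig (Site 2) → RandomPlanarGeometry.CurveClass ℂ,
      RandomPlanarGeometry.ConvergesInLawToSLE 3 D (Ωδ := fun _ => SpinConfig (Site 2)) X
        (fun δ => isingZdDobrushinMeasure (E δ) criticalBetaTwo) :=
  ⟨_, h D E hE⟩

/-- **The corrected statement from the two halves of CDHKS's proof for the leftmost interface**:
if for every discretised Dobrushin domain the laws of the leftmost interfaces are tight near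
`δ = 0` (CDHKS §2; a theorem modulo `fkIsing_rsw`, `exists_isTightMeasureSet_spinInterfaceLaw_leftmost`
in `LeftmostInterfaceTightness.lean`) and their weak subsequential limits along meshes
`u n → 0⁺` are the chordal SLE₃ law (CDHKS §3), then, SLE laws being unique,
`convergesInLawToSLE_three_isingInterface_zd` holds. PROVED
(`convergesInLawToSLE_leftmostInterface_of_tight_of_ident`). [cite: CDHKSCRAS2014, Thm. 1 and §§2–3] -/
theorem convergesInLawToSLE_three_isingInterface_zd_of_tight_of_ident
    (htight : ∀ (D : RandomPlanarGeometry.DobrushinDomain) (E : ℝ → DiscreteDobrushin),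
      IsDiscretisation D E → ∃ δ₀ > 0, IsTightMeasureSet
        (spinInterfaceLaw D E (fun δ => leftmostInterface (E δ)) '' Set.Ioc 0 δ₀))
    (hident : ∀ (D : RandomPlanarGeometry.DobrushinDomain) (E : ℝ → DiscreteDobrushin),
      IsDiscretisation D E → ∀ (u : ℕ → ℝ), Tendsto u atTop (𝓝[>] 0) →
      ∀ (ν : Measure (RandomPlanarGeometry.CurveClass ℂ)) [IsProbabilityMeasure ν],
        (∀ f : RandomPlanarGeometry.CurveClass ℂ →ᵇ ℝ,
          Tendsto (fun n => ∫ c, f c ∂spinInterfaceLaw D E (fun δ => leftmostInterface (E δ)) (u n))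
            atTop (𝓝 (∫ c, f c ∂ν))) →
        RandomPlanarGeometry.IsSLELaw 3 D ν)
    (huniq : RandomPlanarGeometry.IsSLECurve.map_eq) :
    convergesInLawToSLE_three_isingInterface_zd :=
  fun D E hE => convergesInLawToSLE_leftmostInterface_of_tight_of_ident (htight D E hE)
    (fun u hu ν _ hlim => hident D E hE u hu ν hlim) huniq

/-! ### Assembly: the corrected statement from the two named facts -/

/-- **Reduction of crit-ising.S17 (corrected form) to CDHKS's two steps.** Tightness of the
interface laws (`isTightMeasureSet_spinInterfaceLaw`, CDHKS §2) and the identification of every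
subsequential limit as the chordal SLE₃ law (`isSLELaw_three_of_subseqLimit_spinInterface`,
CDHKS §3) — both stated for all selection rules, hence available for a genuine selection rule
agreeing with the leftmost interface at admissible meshes
(`exists_isTightMeasureSet_spinInterfaceLaw_leftmostInterface`,
`isSLELaw_three_of_subseqLimit_leftmostInterface`) — together with uniqueness in law of chordal
SLE_κ in a Dobrushin domain (`IsSLECurve.map_eq`, named fact of `RandomPlanarGeometry/SLE.lean`,
proved in `SLEUniquenessInLaw.lean`), imply convergence in law of the leftmost interface to SLE₃
(`convergesInLawToSLE_three_isingInterface_zd`): Prokhorov and the subsequence principle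
(`convergesInLawToSLE_leftmostInterface_of_facts`). This is the concluding sentence of CDHKS's
proof ("for any subsequential limit of the curves `γ^δ`" ⇒ Thm 1). [cite: CDHKSCRAS2014, §3] -/
theorem convergesInLawToSLE_three_isingInterface_zd_of_facts
    (h₁ : isTightMeasureSet_spinInterfaceLaw) (h₂ : isSLELaw_three_of_subseqLimit_spinInterface)
    (huniq : RandomPlanarGeometry.IsSLECurve.map_eq) : convergesInLawToSLE_three_isingInterface_zd :=
  fun _D _E hE => convergesInLawToSLE_leftmostInterface_of_facts h₁ h₂ huniq hE

end Literature.Probability.LatticeModels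

/-! ### Discharge: every admissible configuration has a Dobrushin interface -/

namespace Literature.Probability.LatticeModels

/-- **Discharge of `exists_isDobrushinInterface`** by the leftmost exploration process of
`DobrushinInterfaceExistence.lean` (`exists_isDobrushinInterface_of_isZdAdmissible`): for
admissible square-lattice Dobrushin data every spin configuration has a Dobrushin interface, so
interface-selection rules are constrained on every configuration (`isDobrushinInterface_sel`).
(CDHKS 2014, §1; Chelkak–Smirnov 2012, §2.2.1 for the leftmost rule.) [cite: CDHKSCRAS2014, §1] -/
theorem exists_isDobrushinInterface_holds : exists_isDobrushinInterface :=
  fun E hE σ => exists_isDobrushinInterface_of_isZdAdmissible E hE σ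

/-- For admissible data, every selection rule selects a genuine Dobrushin interface of every
configuration (unconditional form of `isDobrushinInterface_sel`). (CDHKS 2014, §1.)
[cite: CDHKSCRAS2014, §1] -/
theorem isDobrushinInterface_sel' {E : DiscreteDobrushin} (hE : E.IsZdAdmissible)
    {sel : SpinConfig (Site 2) → List (Sym2 (Site 2))} (hsel : IsInterfaceSelection E sel)
    (σ : SpinConfig (Site 2)) : IsDobrushinInterface E σ (sel σ) :=
  isDobrushinInterface_sel exists_isDobrushinInterface_holds hE hsel σ

end Literature.Probability.LatticeModels

/-! ### Review bookkeeping: where the corrected measure agrees with the original one -/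

namespace Literature.Probability.LatticeModels

/-- If the polygonal boundary of the discrete Dobrushin data is already the vertex boundary
(`zdBoundary ⊆ meshBoundary`, equivalently `=`, as `meshBoundary ⊆ zdBoundary` always holds; this
is the case in particular when `Ω_δ` has no concave lattice corner, since a site of
`zdBoundary ∖ meshBoundary` has all its `ℤ²`-neighbours `Ω_δ`-adjacent and is a corner of a
non-inner face), the two free volumes coincide: `Ω_δ ∖ zdBoundary = Ω_δ ∖ meshBoundary`.
(CDHKS 2014, §1–§2: the boundary conditions live on `∂Ω^δ`, the boundary of the polygonal domain
`Ω^δ_ℂ`.) [cite: CDHKSCRAS2014, §1–§2] -/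
theorem zdInteriorFinset_eq_meshInteriorFinset {E : DiscreteDobrushin}
    (h : E.zdBoundary ⊆ meshBoundary E.Ω E.δ) :
    zdInteriorFinset E = meshInteriorFinset E.Ω E.δ := by
  classical
  refine Finset.Subset.antisymm (zdInteriorFinset_subset_meshInteriorFinset E) ?_
  by_cases hb : Bornology.IsBounded E.Ω ∧ 0 < E.δ
  · intro x hx
    rw [← Finset.mem_coe, coe_meshInteriorFinset hb.1 hb.2] at hx
    rw [← Finset.mem_coe, coe_zdInteriorFinset hb.1 hb.2]
    exact ⟨hx.1, fun hx' => hx.2 (h hx')⟩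
  · have h0 : meshInteriorFinset E.Ω E.δ = ∅ := by
      unfold meshInteriorFinset
      rw [dif_neg hb]
    rw [h0]
    exact Finset.empty_subset _

/-- **Where the corrected statement and the original one speak about the same model.** For
discrete Dobrushin data with `zdBoundary ⊆ meshBoundary` (e.g. without concave lattice corners) the
polygonal Dobrushin Ising measure `isingZdDobrushinMeasure E β` of
`convergesInLawToSLE_three_isingInterface_zd` is the vertex-boundary measure
`isingDobrushinMeasure E β` of `convergesInLawToSLE_three_isingInterface`; in general the two differ
exactly by the thermal spins at the concave corners (§1 of the module docstring). (CDHKS 2014,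
§1 and Thm. 1; Friedli–Velenik 2017, §3.1 for `μ_{Λ;β,h}^η`.) [cite: CDHKSCRAS2014, §1 and Thm. 1] -/
theorem isingZdDobrushinMeasure_eq_isingDobrushinMeasure {E : DiscreteDobrushin}
    (h : E.zdBoundary ⊆ meshBoundary E.Ω E.δ) (β : ℝ) :
    isingZdDobrushinMeasure E β = isingDobrushinMeasure E β := by
  unfold isingZdDobrushinMeasure isingDobrushinMeasure
  rw [zdInteriorFinset_eq_meshInteriorFinset h]

/-- The hypothesis of the two lemmas above in its symmetric form: the polygonal boundary is the
vertex boundary iff it is contained in it. (CDHKS 2014, §1.) [cite: CDHKSCRAS2014, §1] -/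
theorem zdBoundary_eq_meshBoundary_iff (E : DiscreteDobrushin) :
    E.zdBoundary = meshBoundary E.Ω E.δ ↔ E.zdBoundary ⊆ meshBoundary E.Ω E.δ :=
  ⟨fun h => h.le, fun h => Set.Subset.antisymm h E.meshBoundary_subset_zdBoundary⟩

end Literature.Probability.LatticeModels
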